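import Summits.BirchSwinnertonDyer.BirchSwinnertonDyer.Theorems.SignedLowerHalvesSmallImageLowerHalfBothSignsRttE2KLambdaSocketGlue
import HarnessLib

/-!
# Route `SignedLowerHalves`, crux L `SmallImageLowerHalfBothSigns` (item stmt-BirchSwinnertonDyer-23599), line `rtt_w3` v13 — E2, the ONE-SIDED (K)-socket:
# «`(C c)·char_{Λ_𝒪} M ⊆ (C d)·char_{Λ_𝒪} N` ⟹ `lambdaInvariant p N ≤ lambdaInvariant p M`», in particular «`char M · J = char N` ⟹ `λ(M) ≤ λ(N)`»
# — the shape in which road D's specialised skeleton identity `char(Hsp⧸ZSp)·char(H²[f]) = char(Ysp)·char((H¹⧸Z)[f])` feeds the glue's `hK` once the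
# defect `(H¹⧸Z)[f]` vanishes

Width seat `bsd-line-slh-p3-w3` g19 under LEAD `cruxlead-stmt-BirchSwinnertonDyer-23599` g9 (cell `bsd-ssimc`); ROUTE-INDEPENDENT helper
(`--supports stmt-BirchSwinnertonDyer-23599`); THEOREMS ONLY — no definition, no named fact, no instance, no `sorry`; closes nothing; BSD is not proved
by any of this. Sequel of `…RttE2KLambdaSocket` (p775583) / `…RttE2KLambdaSocketGlue` (p775677), which give the two-sided (equality) socket; the
one-sided engine is RTT@2's `CharIdealLambda.lengthAt_le_of_span_singleton_mul_charIdeal_le` + `CharIdealLambda.finrank_baseChange_le_of_lengthAt_le`.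

* §1 `lambdaInvariant_le_of_span_C_mul_charIdeal_le` — carrier `PowerSeries (unitBall p E)`, propositional compatibilities.
* §2 `lambdaInvariant_le_of_span_C_mul_charIdeal_le_iwasawaAlgebraO` — carrier `IwasawaAlgebraO S`, pinned `ι₀ : ℤ_p → 𝒪`.
* §3 ★★ `lambdaInvariant_le_of_span_C_mul_charIdeal_le_of_algebraMap_eq` — the glue's context (`[Algebra Λ Λ_𝒪]`, `halg`, `[IsScalarTower Λ Λ_𝒪 ·]`);
  ★★ `lambdaInvariant_le_of_charIdeal_mul_eq_of_algebraMap_eq` — `char M · J = char N` ⟹ `lambdaInvariant p M ≤ lambdaInvariant p N` (= the glue's `hK` with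
  `M := H ⧸ Λ_𝒪∙z`, `N := Y`, `J := char(H²[f])`); `lambdaInvariant_le_of_charIdeal_le_of_algebraMap_eq` (`char N ⊆ char M`).

References: [Washington1997] §13.2; [BourbakiAC5to7] VII §4.5; [SkinnerUrban2014] §3.1.6.
-/

set_option autoImplicit false
-- the Theorems namespace of this sub repeats the summit name by design (D-0017 nested layout)
set_option linter.dupNamespace false

noncomputable section

open scoped TensorProduct
open Literature.NumberTheory.Automorphic Literature.NumberTheory.EllipticCurves

namespace Summit.BirchSwinnertonDyer.BirchSwinnertonDyer.Theorems.SmallImageRttE2Num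

universe v v'

section UnitBall

variable (p : ℕ) [Fact p.Prime] (E : IntermediateField ℚ_[p] (PadicAlgCl p)) [FiniteDimensional ℚ_[p] E]

/-- **One-sided (K)-socket, carrier `𝒪⟦T⟧`, `𝒪 = unitBall p E`.** For f.g. torsion `Λ_𝒪`-modules `M`, `N` with compatible `𝒪`-, `ℤ_p`- and
`Λ`-structures and `c, d ∈ 𝒪 ∖ 0`: `(C c)·char(M) ⊆ (C d)·char(N)` ⟹ `lambdaInvariant p N ≤ lambdaInvariant p M` (the local lengths of `N` are
bounded by those of `M` at every height-one prime off `ϖ`, and `λ` is the `ϖ`-free length sum). [cite: Washington1997, §13.2] [cite: SkinnerUrban2014, §3.1.6] -/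
theorem lambdaInvariant_le_of_span_C_mul_charIdeal_le (M : Type v) (N : Type v') [AddCommGroup M] [AddCommGroup N]
    [Module (PowerSeries (PadicIntermediateField.unitBall p E)) M] [Module (PowerSeries (PadicIntermediateField.unitBall p E)) N]
    [Module.Finite (PowerSeries (PadicIntermediateField.unitBall p E)) M] [Module.Finite (PowerSeries (PadicIntermediateField.unitBall p E)) N]
    (hM : Module.IsTorsion (PowerSeries (PadicIntermediateField.unitBall p E)) M)
    (hN : Module.IsTorsion (PowerSeries (PadicIntermediateField.unitBall p E)) N)
    [Module (PadicIntermediateField.unitBall p E) M] [Module (PadicIntermediateField.unitBall p E) N]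
    (h𝒪M : ∀ (a : PadicIntermediateField.unitBall p E) (m : M), (PowerSeries.C a) • m = a • m)
    (h𝒪N : ∀ (a : PadicIntermediateField.unitBall p E) (n : N), (PowerSeries.C a) • n = a • n)
    [Module ℤ_[p] M] [Module ℤ_[p] N]
    (hℤM : ∀ (r : ℤ_[p]) (m : M), (algebraMap ℤ_[p] (PadicIntermediateField.unitBall p E) r) • m = r • m)
    (hℤN : ∀ (r : ℤ_[p]) (n : N), (algebraMap ℤ_[p] (PadicIntermediateField.unitBall p E) r) • n = r • n)
    [Module (IwasawaAlgebra p) M] [Module (IwasawaAlgebra p) N]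
    (hΛM : ∀ (r : ℤ_[p]) (m : M), (PowerSeries.C r : IwasawaAlgebra p) • m = r • m)
    (hΛN : ∀ (r : ℤ_[p]) (n : N), (PowerSeries.C r : IwasawaAlgebra p) • n = r • n)
    {c d : PadicIntermediateField.unitBall p E} (hc : c ≠ 0) (hd : d ≠ 0)
    (h : Ideal.span {(PowerSeries.C c : PowerSeries (PadicIntermediateField.unitBall p E))} *
        Module.charIdeal (PowerSeries (PadicIntermediateField.unitBall p E)) M ≤
      Ideal.span {(PowerSeries.C d : PowerSeries (PadicIntermediateField.unitBall p E))} *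
        Module.charIdeal (PowerSeries (PadicIntermediateField.unitBall p E)) N) :
    lambdaInvariant p N ≤ lambdaInvariant p M := by
  haveI : IsScalarTower (PadicIntermediateField.unitBall p E) (PowerSeries (PadicIntermediateField.unitBall p E)) M :=
    IsScalarTower.of_algebraMap_smul h𝒪M
  haveI : IsScalarTower (PadicIntermediateField.unitBall p E) (PowerSeries (PadicIntermediateField.unitBall p E)) N :=
    IsScalarTower.of_algebraMap_smul h𝒪N
  haveI := LambdaLowerBoundO.isDiscreteValuationRing_unitBall p E
  haveI := LambdaLowerBoundO.isAdicComplete_maximalIdeal_unitBall p E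
  haveI : IsFractionRing (PadicIntermediateField.unitBall p E) E :=
    IsIntegralClosure.isFractionRing_of_finite_extension ℤ_[p] ℚ_[p] E (PadicIntermediateField.unitBall p E)
  obtain ⟨ϖ, hϖ⟩ := IsDiscreteValuationRing.exists_irreducible (PadicIntermediateField.unitBall p E)
  have hC : ∀ {a : PadicIntermediateField.unitBall p E}, a ≠ 0 →
      (PowerSeries.C a : PowerSeries (PadicIntermediateField.unitBall p E)) ≠ 0 := fun ha h0 ↦
    ha (by simpa using congrArg PowerSeries.constantCoeff h0)
  rw [lambdaInvariant_eq_mul_finrank_baseChange_unitBall p E M hℤM hΛM, lambdaInvariant_eq_mul_finrank_baseChange_unitBall p E N hℤN hΛN]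
  exact Nat.mul_le_mul_left _ (CharIdealLambda.finrank_baseChange_le_of_lengthAt_le E hϖ N M hN hM fun 𝔭 h1 hϖ𝔭 ↦
    CharIdealLambda.lengthAt_le_of_span_singleton_mul_charIdeal_le hM hN (hC hc) (hC hd) h 𝔭 h1
      (fun h' ↦ hϖ𝔭 (CharIdealLambda.C_mem_of_C_mem hϖ hc 𝔭 h')) (fun h' ↦ hϖ𝔭 (CharIdealLambda.C_mem_of_C_mem hϖ hd 𝔭 h')))

end UnitBall

section CoeffIntegers

variable (p : ℕ) [Fact p.Prime] (S : Set (PadicAlgCl p)) [FiniteDimensional ℚ_[p] (padicCoeffField S)]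

/-- **One-sided (K)-socket on `IwasawaAlgebraO S`, pinned form** (any `ι₀ : ℤ_p → 𝒪 = padicCoeffIntegers S` compatible with `ℚ̄_p`; `Λ`-structures
pinned by `(C r : Λ)•m = (C (ι₀ r) : Λ_𝒪)•m`): `(C c)·char(M) ⊆ (C d)·char(N)` ⟹ `lambdaInvariant p N ≤ lambdaInvariant p M`. [cite: Washington1997, §13.2] -/
theorem lambdaInvariant_le_of_span_C_mul_charIdeal_le_iwasawaAlgebraO :
    ∀ (ι₀ : ℤ_[p] →+* padicCoeffIntegers S),
      (∀ x : ℤ_[p], ((ι₀ x : padicCoeffIntegers S) : PadicAlgCl p) = algebraMap ℚ_[p] (PadicAlgCl p) (x : ℚ_[p])) →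
    ∀ (M N : Type v) [AddCommGroup M] [AddCommGroup N] [Module (IwasawaAlgebraO S) M] [Module (IwasawaAlgebraO S) N]
      [Module.Finite (IwasawaAlgebraO S) M] [Module.Finite (IwasawaAlgebraO S) N]
      [Module (IwasawaAlgebra p) M] [Module (IwasawaAlgebra p) N],
      Module.IsTorsion (IwasawaAlgebraO S) M → Module.IsTorsion (IwasawaAlgebraO S) N →
      (∀ (r : ℤ_[p]) (m : M), (PowerSeries.C r : IwasawaAlgebra p) • m = (PowerSeries.C (ι₀ r) : IwasawaAlgebraO S) • m) →
      (∀ (r : ℤ_[p]) (n : N), (PowerSeries.C r : IwasawaAlgebra p) • n = (PowerSeries.C (ι₀ r) : IwasawaAlgebraO S) • n) →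
    ∀ (c d : padicCoeffIntegers S), c ≠ 0 → d ≠ 0 →
      Ideal.span {(PowerSeries.C c : IwasawaAlgebraO S)} * Module.charIdeal (IwasawaAlgebraO S) M ≤
        Ideal.span {(PowerSeries.C d : IwasawaAlgebraO S)} * Module.charIdeal (IwasawaAlgebraO S) N →
      lambdaInvariant p N ≤ lambdaInvariant p M := by
  unfold IwasawaAlgebraO
  rw [padicCoeffIntegers_eq_unitBall S]
  intro ι₀ hι₀ M N _ _ _ _ _ _ _ _ hM hN hΛM hΛN c d hc hd h
  -- `ι₀` is the structure map
  have hι : ι₀ = algebraMap ℤ_[p] (PadicIntermediateField.unitBall p (padicCoeffField S)) := by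
    refine RingHom.ext fun x ↦ Subtype.ext ?_
    rw [hι₀ x]
    change algebraMap ℚ_[p] (PadicAlgCl p) (x : ℚ_[p]) = algebraMap ℤ_[p] (PadicAlgCl p) x
    rw [IsScalarTower.algebraMap_apply ℤ_[p] ℚ_[p] (PadicAlgCl p), PadicInt.algebraMap_apply]
  subst hι
  -- manufacture the `𝒪`- and `ℤ_p`-structures by restriction along `C` and `C ∘ algebraMap`
  letI mOM : Module (PadicIntermediateField.unitBall p (padicCoeffField S)) M :=
    Module.compHom M (PowerSeries.C : PadicIntermediateField.unitBall p (padicCoeffField S) →+* _)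
  letI mON : Module (PadicIntermediateField.unitBall p (padicCoeffField S)) N :=
    Module.compHom N (PowerSeries.C : PadicIntermediateField.unitBall p (padicCoeffField S) →+* _)
  letI mZM : Module ℤ_[p] M := Module.compHom M
    ((PowerSeries.C : PadicIntermediateField.unitBall p (padicCoeffField S) →+* _).comp
      (algebraMap ℤ_[p] (PadicIntermediateField.unitBall p (padicCoeffField S))))
  letI mZN : Module ℤ_[p] N := Module.compHom N
    ((PowerSeries.C : PadicIntermediateField.unitBall p (padicCoeffField S) →+* _).comp
      (algebraMap ℤ_[p] (PadicIntermediateField.unitBall p (padicCoeffField S))))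
  exact lambdaInvariant_le_of_span_C_mul_charIdeal_le p (padicCoeffField S) M N hM hN (fun _ _ ↦ rfl) (fun _ _ ↦ rfl)
    (fun _ _ ↦ rfl) (fun _ _ ↦ rfl) (fun r m ↦ hΛM r m) (fun r n ↦ hΛN r n) hc hd h

/-- ★★ **One-sided (K)-socket in the glue's instance context** (`[Algebra Λ Λ_𝒪]` pinned by `halg`, `[IsScalarTower Λ Λ_𝒪 ·]`, as in
`SmallImageRttCharRoad.charRoad_E2_of_parts`): for f.g. torsion `Λ_𝒪`-modules `M`, `N` and `c, d ∈ 𝒪 ∖ 0`,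
`(C c)·char(M) ⊆ (C d)·char(N)` ⟹ `lambdaInvariant p N ≤ lambdaInvariant p M`. [cite: Washington1997, §13.2] [cite: SkinnerUrban2014, §3.1.6] -/
theorem lambdaInvariant_le_of_span_C_mul_charIdeal_le_of_algebraMap_eq [Algebra (IwasawaAlgebra p) (IwasawaAlgebraO S)]
    (halg : ∀ r : IwasawaAlgebra p, algebraMap (IwasawaAlgebra p) (IwasawaAlgebraO S) r = iwasawaToIwasawaO S r)
    (M N : Type v) [AddCommGroup M] [AddCommGroup N] [Module (IwasawaAlgebraO S) M] [Module (IwasawaAlgebraO S) N]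
    [Module.Finite (IwasawaAlgebraO S) M] [Module.Finite (IwasawaAlgebraO S) N]
    [Module (IwasawaAlgebra p) M] [Module (IwasawaAlgebra p) N]
    [IsScalarTower (IwasawaAlgebra p) (IwasawaAlgebraO S) M] [IsScalarTower (IwasawaAlgebra p) (IwasawaAlgebraO S) N]
    (hM : Module.IsTorsion (IwasawaAlgebraO S) M) (hN : Module.IsTorsion (IwasawaAlgebraO S) N)
    {c d : padicCoeffIntegers S} (hc : c ≠ 0) (hd : d ≠ 0)
    (h : Ideal.span {(PowerSeries.C c : IwasawaAlgebraO S)} * Module.charIdeal (IwasawaAlgebraO S) M ≤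
      Ideal.span {(PowerSeries.C d : IwasawaAlgebraO S)} * Module.charIdeal (IwasawaAlgebraO S) N) :
    lambdaInvariant p N ≤ lambdaInvariant p M := by
  have hC : ∀ r : ℤ_[p], algebraMap (IwasawaAlgebra p) (IwasawaAlgebraO S) (PowerSeries.C r) =
      PowerSeries.C (padicIntToCoeffIntegers S r) := fun r ↦ by
    rw [halg]; unfold iwasawaToIwasawaO; rw [PowerSeries.map_C]
  refine lambdaInvariant_le_of_span_C_mul_charIdeal_le_iwasawaAlgebraO p S (padicIntToCoeffIntegers S)
    (coe_padicIntToCoeffIntegers S) M N hM hN (fun r m ↦ ?_) (fun r n ↦ ?_) c d hc hd h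
  · rw [← IsScalarTower.algebraMap_smul (IwasawaAlgebraO S) (PowerSeries.C r : IwasawaAlgebra p) m, hC]
  · rw [← IsScalarTower.algebraMap_smul (IwasawaAlgebraO S) (PowerSeries.C r : IwasawaAlgebra p) n, hC]

/-- **`char(N) ⊆ char(M)` ⟹ `lambdaInvariant p N ≤ lambdaInvariant p M`** in the glue's context (the case `c = d = 1`: "`char M ∣ char N`").
[cite: Washington1997, §13.2] -/
theorem lambdaInvariant_le_of_charIdeal_le_of_algebraMap_eq [Algebra (IwasawaAlgebra p) (IwasawaAlgebraO S)]
    (halg : ∀ r : IwasawaAlgebra p, algebraMap (IwasawaAlgebra p) (IwasawaAlgebraO S) r = iwasawaToIwasawaO S r)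
    (M N : Type v) [AddCommGroup M] [AddCommGroup N] [Module (IwasawaAlgebraO S) M] [Module (IwasawaAlgebraO S) N]
    [Module.Finite (IwasawaAlgebraO S) M] [Module.Finite (IwasawaAlgebraO S) N]
    [Module (IwasawaAlgebra p) M] [Module (IwasawaAlgebra p) N]
    [IsScalarTower (IwasawaAlgebra p) (IwasawaAlgebraO S) M] [IsScalarTower (IwasawaAlgebra p) (IwasawaAlgebraO S) N]
    (hM : Module.IsTorsion (IwasawaAlgebraO S) M) (hN : Module.IsTorsion (IwasawaAlgebraO S) N)
    (h : Module.charIdeal (IwasawaAlgebraO S) M ≤ Module.charIdeal (IwasawaAlgebraO S) N) :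
    lambdaInvariant p N ≤ lambdaInvariant p M :=
  lambdaInvariant_le_of_span_C_mul_charIdeal_le_of_algebraMap_eq p S halg M N hM hN (c := 1) (d := 1) one_ne_zero one_ne_zero
    (by simpa only [map_one, Ideal.span_singleton_one, Ideal.top_mul] using h)

/-- ★★ **`char(M)·J = char(N)` ⟹ `lambdaInvariant p M ≤ lambdaInvariant p N`** in the glue's context — the glue's `hK` with `M := H ⧸ Λ_𝒪∙z`, `N := Y`:
road D's specialised skeleton identity `char(Hsp ⧸ ZSp)·char(H²[f]) = char(Ysp)·char((H¹⧸Z)[f])` (`…RttD2SpecialisationOfSkeleton`) with vanishing defect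
`(H¹⧸Z)[f] = 0` is exactly this shape with `J := char(H²[f])`. [cite: Washington1997, §13.2] [cite: JohnsonLeungKings2011, Cor. 5.3] -/
theorem lambdaInvariant_le_of_charIdeal_mul_eq_of_algebraMap_eq [Algebra (IwasawaAlgebra p) (IwasawaAlgebraO S)]
    (halg : ∀ r : IwasawaAlgebra p, algebraMap (IwasawaAlgebra p) (IwasawaAlgebraO S) r = iwasawaToIwasawaO S r)
    (M N : Type v) [AddCommGroup M] [AddCommGroup N] [Module (IwasawaAlgebraO S) M] [Module (IwasawaAlgebraO S) N]
    [Module.Finite (IwasawaAlgebraO S) M] [Module.Finite (IwasawaAlgebraO S) N]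
    [Module (IwasawaAlgebra p) M] [Module (IwasawaAlgebra p) N]
    [IsScalarTower (IwasawaAlgebra p) (IwasawaAlgebraO S) M] [IsScalarTower (IwasawaAlgebra p) (IwasawaAlgebraO S) N]
    (hM : Module.IsTorsion (IwasawaAlgebraO S) M) (hN : Module.IsTorsion (IwasawaAlgebraO S) N)
    (J : Ideal (IwasawaAlgebraO S)) (h : Module.charIdeal (IwasawaAlgebraO S) M * J = Module.charIdeal (IwasawaAlgebraO S) N) :
    lambdaInvariant p M ≤ lambdaInvariant p N :=
  lambdaInvariant_le_of_charIdeal_le_of_algebraMap_eq p S halg N M hN hM (h ▸ Ideal.mul_le_right)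

end CoeffIntegers

end Summit.BirchSwinnertonDyer.BirchSwinnertonDyer.Theorems.SmallImageRttE2Num

end
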